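import Literature.AlgebraicGeometry.Resolution.EtaleChartNormal
import Mathlib.RingTheory.Valuation.ValuationSubring
import HarnessLib

/-!
# The cut of the disc in integral form, from its valuative form

Topic: `Literature/AlgebraicGeometry/Resolution` (valued function fields). Provider-side glue for
the chart datum of M. Temkin, *Inseparable local uniformization*, J. Algebra 373 (2013),
Thm. 3.3.1 (tree: `RelCurveChart`, `RelativeCurveChartSetup.lean`): its field `hx'int` asks that
the disc coordinate `x′ = (x − a)/c` (times a power of a `V`-unit) be INTEGRAL over the
`m°`-algebra `R = m°[S]` generated by a set `S ∋ b⁻¹` (`b` the sheet cutter). When the cut is known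
in VALUATIVE form — `b ∈ W`, and `|b|_W = 1 ⇒ |x − a|_W ≤ |c|_W`, for every valuation ring
`W ⊇ S` inducing `V` on the constants `M` (the absolute case, `DiscCutoutPackage.lean`) — the
integral form follows with exponent `0` from the valuative criterion for integrality
(`isIntegral_of_forall_valuationSubring`, `EtaleChartNormal.lean`) and the height-one dichotomy
for valuation rings over `m°` (a valuation ring containing `m°` either contains `m`, or induces
`m ∩ O_V` on `m` and then — `hGal` — `O_V` on `M`); the variable `M` only enters through `hGal`.

* `mem_of_cut_valuative` — `x′ ∈ W` for every valuation ring `W ⊇ m°[S]` — PROVED;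
* `isIntegral_cut_of_valuative` — **`x′` is integral over `m°[S]`** — PROVED.

All statements are [folklore]; no definitions, no named facts.

## Sources

* M. Temkin, arXiv:0804.1554v3, proof of Thm. 3.3.1, Step 3 (the cut-out). [Temkin2013]
-/

noncomputable section

namespace Literature.AlgebraicGeometry.Resolution

universe u

variable {Ω : Type u} [Field Ω] (V : ValuationSubring Ω) (m M : Subfield Ω)

/-- **The disc coordinate lies in every valuation ring over the ring of the cut.** Data: the
constants `m ≤ M` with the height-one dichotomy (`hmax`) and the sheet property (`hGal`); a set `S ∋ b⁻¹` of generators; the valuative cut: `b ∈ W` and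
`|b|_W = 1 ⇒ |x − a|_W ≤ |c|_W` for valuation rings `W ⊇ S` inducing `V` on `M`; `a, c ∈ m`,
`c ≠ 0`. Conclusion: `(x − a)/c ∈ W` for every valuation ring `W` containing `m° = O_V ∩ m` and
`S`. [folklore] -/
theorem mem_of_cut_valuative
    (hmax : ∀ W : ValuationSubring Ω, (∀ μ ∈ m, μ ∈ V → μ ∈ W) →
      (∀ μ ∈ m, μ ∈ W) ∨ (∀ μ ∈ m, μ ∈ W ↔ μ ∈ V))
    (hGal : ∀ W : ValuationSubring Ω, (∀ μ ∈ m, μ ∈ W ↔ μ ∈ V) → ∀ μ ∈ M, μ ∈ W ↔ μ ∈ V)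
    (S : Set Ω) {x a c b : Ω} (ham : a ∈ m) (hcm : c ∈ m) (hc0 : c ≠ 0) (hb0 : b ≠ 0)
    (hbS : b⁻¹ ∈ S) (hxS : x ∈ S)
    (hbmem : ∀ W : ValuationSubring Ω, S ⊆ W → (∀ μ ∈ M, μ ∈ W ↔ μ ∈ V) → b ∈ W)
    (hbcut : ∀ W : ValuationSubring Ω, S ⊆ W → (∀ μ ∈ M, μ ∈ W ↔ μ ∈ V) →
      W.valuation b = 1 → W.valuation (x - a) ≤ W.valuation c)
    (W : ValuationSubring Ω) (hmW : ∀ μ ∈ m, μ ∈ V → μ ∈ W) (hSW : S ⊆ W) :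
    (x - a) / c ∈ W := by
  have hxW : x ∈ W := hSW hxS
  rcases hmax W hmW with h | h
  · -- `m ⊆ W`: `|c|_W = 1`
    have hc1 : W.valuation c = 1 := by
      have h1 : c ∈ W := h _ hcm
      have h2 : c⁻¹ ∈ W := h _ (m.inv_mem hcm)
      refine le_antisymm ((W.valuation_le_one_iff _).mpr h1) ?_
      have h3 := (W.valuation_le_one_iff _).mpr h2
      rwa [map_inv₀, inv_le_one₀ ((Valuation.pos_iff _).mpr hc0)] at h3
    rw [← W.valuation_le_one_iff, map_div₀, hc1, div_one]
    exact (W.valuation_le_one_iff _).mpr (W.sub_mem hxW (h _ ham))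
  · have hM := hGal W h
    have hbW : b ∈ W := hbmem W hSW hM
    have hb1 : W.valuation b = 1 := by
      have h2 : b⁻¹ ∈ W := hSW hbS
      refine le_antisymm ((W.valuation_le_one_iff _).mpr hbW) ?_
      have h3 := (W.valuation_le_one_iff _).mpr h2
      rwa [map_inv₀, inv_le_one₀ ((Valuation.pos_iff _).mpr hb0)] at h3
    have hle := hbcut W hSW hM hb1
    rw [← W.valuation_le_one_iff, map_div₀]
    exact div_le_one_of_le₀ hle zero_le

/-- **The cut in integral form** (field `hx'int` of `RelCurveChart`, exponent `0`, unit `1`):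
under the hypotheses of `mem_of_cut_valuative`, `(x − a)/c` is integral over `m°[S]`. [folklore] -/
theorem isIntegral_cut_of_valuative
    (hmax : ∀ W : ValuationSubring Ω, (∀ μ ∈ m, μ ∈ V → μ ∈ W) →
      (∀ μ ∈ m, μ ∈ W) ∨ (∀ μ ∈ m, μ ∈ W ↔ μ ∈ V))
    (hGal : ∀ W : ValuationSubring Ω, (∀ μ ∈ m, μ ∈ W ↔ μ ∈ V) → ∀ μ ∈ M, μ ∈ W ↔ μ ∈ V)
    (S : Set Ω) {x a c b : Ω} (ham : a ∈ m) (hcm : c ∈ m) (hc0 : c ≠ 0) (hb0 : b ≠ 0)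
    (hbS : b⁻¹ ∈ S) (hxS : x ∈ S)
    (hbmem : ∀ W : ValuationSubring Ω, S ⊆ W → (∀ μ ∈ M, μ ∈ W ↔ μ ∈ V) → b ∈ W)
    (hbcut : ∀ W : ValuationSubring Ω, S ⊆ W → (∀ μ ∈ M, μ ∈ W ↔ μ ∈ V) →
      W.valuation b = 1 → W.valuation (x - a) ≤ W.valuation c) :
    IsIntegral (Algebra.adjoin (V.toSubring ⊓ m.toSubring : Subring Ω) S) ((x - a) / c) := by
  set R := Algebra.adjoin (V.toSubring ⊓ m.toSubring : Subring Ω) S with hR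
  refine isIntegral_of_forall_valuationSubring (T := R) (L := Ω) fun W hW => ?_
  refine mem_of_cut_valuative V m M hmax hGal S ham hcm hc0 hb0 hbS hxS hbmem hbcut W
    (fun μ hμm hμV => ?_) fun w hw => ?_
  · exact hW ⟨_, R.algebraMap_mem ⟨μ, Subring.mem_inf.mpr ⟨hμV, hμm⟩⟩⟩
  · exact hW ⟨w, Algebra.subset_adjoin hw⟩

end Literature.AlgebraicGeometry.Resolution

end
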